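import Mathlib
import Summits.MatrixMultiplication.MatrixMultiplication.Theorems.SubgroupIdentityDesigns.Negative.PMemberLaw
import Summits.MatrixMultiplication.MatrixMultiplication.Theorems.SubgroupIdentityDesigns.Negative.PThree

/-!
# The `(2,1)` cell of `SubgroupIdentityDesigns`, all odd primes: a witness is `p`-free with `p ≥ 5`

Route `LevelGradedCohnUmans`, crux `SubgroupIdentityDesigns`, the `(m,k) = (2,1)` cell.

One citable statement assembling the `p`-member law (`PMemberLaw.coprime_of_levelOne_witness`,
`p ≥ 5`) and the `p = 3` theorem (`PThree.no_levelOne_witness_three`):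

* `levelOne_witness_pfree_profile`: for every prime `p ≥ 3` and `0 < ε ≤ 1`, a subgroup TPP triple of
  `GL₂(𝔽_p)` carrying a level-`1` identity design and satisfying the crux inequality has `p ≥ 5`
  and all three members of order prime to `p`.

(`p = 2` is `LevelOneDimSqueeze.no_levelOne_witness_small_eps`.)  What remains of the cell as a
theorem is the `p`-free case, `p ≥ 5` — empty at `p = 5, 7` by the exact design test (data, route
folder `ORACLE-g14.md` §G14-15), no theorem yet.  VALUE = THEOREM (assembly), NOT summit progress;
the crux item stmt-MatrixMultiplication-14079 is untouched and remains open.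
-/

set_option linter.dupNamespace false

noncomputable section

open scoped BigOperators Classical

open Summit.MatrixMultiplication.MatrixMultiplication.Theorems.LieRankDesigns.Negative
  (GLm Mat fourierFn budget)

namespace Summit.MatrixMultiplication.MatrixMultiplication.Theorems.SubgroupIdentityDesigns.Negative

section CellStatus

open Literature.Barriers.MatrixMultiplication (SubgroupTPP)

variable {p : ℕ} [hp : Fact p.Prime]

/-- **Profile of a `(2,1)` level-one witness, all primes `p ≥ 3`, `0 < ε ≤ 1`:** `p ≥ 5` and the
three members are `p`-free. -/
theorem levelOne_witness_pfree_profile (hp3 : 3 ≤ p) {ε : ℝ} (hε : 0 < ε) (hε1 : ε ≤ 1)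
    {H₁ H₂ H₃ : Subgroup (GLm p 2)} (htpp : SubgroupTPP H₁ H₂ H₃)
    (hdesign : ∃ c : Mat p 2 → ℂ, (∀ M, 1 < M.rank → c M = 0) ∧
      (∑ M, c M * ZMod.stdAddChar (Matrix.trace (M * ((1 : GLm p 2) : Mat p 2)))) = 1 ∧
      ∀ a ∈ H₁, ∀ b ∈ H₂, ∀ g ∈ H₃, a * b * g ≠ 1 →
        (∑ M, c M *
          ZMod.stdAddChar (Matrix.trace (M * ((a * b * g : GLm p 2) : Mat p 2)))) = 0)
    (hwit : budget p 2 1 (2 + ε) <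
      ((Nat.card H₁ * Nat.card H₂ * Nat.card H₃ : ℕ) : ℝ) ^ ((2 + ε) / 3)) :
    5 ≤ p ∧ ¬ p ∣ Nat.card H₁ ∧ ¬ p ∣ Nat.card H₂ ∧ ¬ p ∣ Nat.card H₃ := by
  have hp5 : 5 ≤ p := by
    by_contra hlt
    have hp4 : p ≠ 4 := by
      rintro rfl; exact absurd hp.out (by decide)
    have h3 : p = 3 := by omega
    subst h3
    exact no_levelOne_witness_three hε hε1 htpp hdesign hwit
  exact ⟨hp5, coprime_of_levelOne_witness hp5 hε hε1 htpp hdesign hwit⟩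

/-- The same, negatively: for `p ≥ 3` and `0 < ε ≤ 1` there is no `(2,1)` level-one witness with a
member of order divisible by `p`, and none at all at `p = 3`. -/
theorem no_levelOne_witness_unless_pfree (hp3 : 3 ≤ p) {ε : ℝ} (hε : 0 < ε) (hε1 : ε ≤ 1)
    {H₁ H₂ H₃ : Subgroup (GLm p 2)} (htpp : SubgroupTPP H₁ H₂ H₃)
    (hdvd : p = 3 ∨ p ∣ Nat.card H₁ ∨ p ∣ Nat.card H₂ ∨ p ∣ Nat.card H₃)
    (hdesign : ∃ c : Mat p 2 → ℂ, (∀ M, 1 < M.rank → c M = 0) ∧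
      (∑ M, c M * ZMod.stdAddChar (Matrix.trace (M * ((1 : GLm p 2) : Mat p 2)))) = 1 ∧
      ∀ a ∈ H₁, ∀ b ∈ H₂, ∀ g ∈ H₃, a * b * g ≠ 1 →
        (∑ M, c M *
          ZMod.stdAddChar (Matrix.trace (M * ((a * b * g : GLm p 2) : Mat p 2)))) = 0) :
    ¬ budget p 2 1 (2 + ε) <
      ((Nat.card H₁ * Nat.card H₂ * Nat.card H₃ : ℕ) : ℝ) ^ ((2 + ε) / 3) := by
  intro hwit
  obtain ⟨hp5, h₁, h₂, h₃⟩ := levelOne_witness_pfree_profile hp3 hε hε1 htpp hdesign hwit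
  rcases hdvd with h | h | h | h
  · omega
  · exact h₁ h
  · exact h₂ h
  · exact h₃ h

/-- **The crux's own `(m,k) = (2,1)` clause, verbatim, is unsatisfiable for `p ≥ 3`, `0 < ε ≤ 1`
unless `p ≥ 5` and the triple is `p`-free** (definitional unfolding of `budget`). -/
theorem no_crux_instance_two_one_unless_pfree (hp3 : 3 ≤ p) {ε : ℝ} (hε : 0 < ε) (hε1 : ε ≤ 1)
    (H₁ H₂ H₃ : Subgroup (Matrix.GeneralLinearGroup (Fin 2) (ZMod p)))
    (hdvd : p = 3 ∨ p ∣ Nat.card H₁ ∨ p ∣ Nat.card H₂ ∨ p ∣ Nat.card H₃) :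
    ¬ (Literature.Barriers.MatrixMultiplication.SubgroupTPP H₁ H₂ H₃ ∧
      (∃ c : Matrix (Fin 2) (Fin 2) (ZMod p) → ℂ, (∀ M, 1 < M.rank → c M = 0) ∧
        (∑ M : Matrix (Fin 2) (Fin 2) (ZMod p), c M * ZMod.stdAddChar (Matrix.trace (M *
          ((1 : Matrix.GeneralLinearGroup (Fin 2) (ZMod p)) : Matrix (Fin 2) (Fin 2) (ZMod p)))))
          = 1 ∧
        ∀ a ∈ H₁, ∀ b ∈ H₂, ∀ g ∈ H₃, a * b * g ≠ 1 →
          (∑ M : Matrix (Fin 2) (Fin 2) (ZMod p), c M * ZMod.stdAddChar (Matrix.trace (M *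
            ((a * b * g : Matrix.GeneralLinearGroup (Fin 2) (ZMod p)) :
              Matrix (Fin 2) (Fin 2) (ZMod p))))) = 0) ∧
      (∑ᶠ χ ∈ Literature.RepresentationTheory.FiniteGroups.irrChars
          (Matrix.GeneralLinearGroup (Fin 2) (ZMod p)) ∩
          {f | ∃ c : Matrix (Fin 2) (Fin 2) (ZMod p) → ℂ, (∀ M, 1 < M.rank → c M = 0) ∧
            ∀ g : Matrix.GeneralLinearGroup (Fin 2) (ZMod p), f g =
              ∑ M : Matrix (Fin 2) (Fin 2) (ZMod p), c M * ZMod.stdAddChar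
                (Matrix.trace (M * (g : Matrix (Fin 2) (Fin 2) (ZMod p))))},
        (χ 1).re ^ (2 + ε)) <
        ((Nat.card H₁ * Nat.card H₂ * Nat.card H₃ : ℕ) : ℝ) ^ ((2 + ε) / 3)) := by
  rintro ⟨htpp, hdesign, hlt⟩
  exact no_levelOne_witness_unless_pfree hp3 hε hε1 htpp hdvd hdesign hlt

end CellStatus

end Summit.MatrixMultiplication.MatrixMultiplication.Theorems.SubgroupIdentityDesigns.Negative

end
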